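import Mathlib
import HarnessLib
import Summits.HubbardSuperconductivity.HubbardSuperconductivity.Theorems.WeakCouplingBCSDefsKlCertB1gWinU1Record
import Summits.HubbardSuperconductivity.HubbardSuperconductivity.Theorems.WeakCouplingBCSDefsKlCertB1gWinU2Record
import Summits.HubbardSuperconductivity.HubbardSuperconductivity.Theorems.WeakCouplingBCSDefsKlCertB1gWinU3Record
import Summits.HubbardSuperconductivity.HubbardSuperconductivity.Theorems.WeakCouplingBCSDefsKlCertB1gWinVRecord
import Summits.HubbardSuperconductivity.HubbardSuperconductivity.Theorems.WeakCouplingBCSDefsKlCertB1gWinWRecord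
import Summits.HubbardSuperconductivity.HubbardSuperconductivity.Theorems.WeakCouplingBCSDefsKlCertB1gWinXRecord
import Summits.HubbardSuperconductivity.HubbardSuperconductivity.Theorems.WeakCouplingBCSDefsKlCertB1gWinYRecord
import Summits.HubbardSuperconductivity.HubbardSuperconductivity.Theorems.WeakCouplingBCSDefsKlCertB1gWinZRecord
import Summits.HubbardSuperconductivity.HubbardSuperconductivity.Theorems.WeakCouplingBCSDefsKlU0WindowD010D035Record
import Summits.HubbardSuperconductivity.HubbardSuperconductivity.Theorems.WeakCouplingBCSDefsKlU0WindowU1Record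
import Summits.HubbardSuperconductivity.HubbardSuperconductivity.Theorems.WeakCouplingBCSDefsKlU0WindowU32Record
import Summits.HubbardSuperconductivity.HubbardSuperconductivity.Theorems.WeakCouplingBCSDefsKlU0WindowWVRecord
import Summits.HubbardSuperconductivity.HubbardSuperconductivity.Theorems.WeakCouplingBCSDefsKlU0WindowYXRecord
import Summits.HubbardSuperconductivity.HubbardSuperconductivity.Theorems.WeakCouplingBCSDefsKlU0WindowZRecord
import Summits.HubbardSuperconductivity.HubbardSuperconductivity.Theorems.WeakCouplingBCSKlAllOrdersSelectionWindow
import Summits.HubbardSuperconductivity.HubbardSuperconductivity.Theorems.WeakCouplingBCSKlSelectionBoxwiseRows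
import Summits.HubbardSuperconductivity.HubbardSuperconductivity.Theorems.WeakCouplingBCSKlSelectionJoinRows
import Summits.HubbardSuperconductivity.HubbardSuperconductivity.Theorems.WeakCouplingBCSKlSelectionWindowD010D030
import Summits.HubbardSuperconductivity.HubbardSuperconductivity.Theorems.WeakCouplingBCSKlSelectionWindowRows
import Summits.HubbardSuperconductivity.HubbardSuperconductivity.Theorems.WeakCouplingBCSKlThirdOrderSelectionWindow
import Summits.HubbardSuperconductivity.HubbardSuperconductivity.Theorems.WeakCouplingBCSWcbcsKohnLuttingerB1gFormAWindowD005D035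

/-!
# Route `WeakCouplingBCS` — channel-margin lane of `WcbcsKohnLuttingerB1g` (stmt-HubbardSuperconductivity-0158):
# `B1g` SELECTION THROUGH THIRD ORDER / RESUMMED CHAINS / ALL ORDERS / CHANNEL BOTTOMS ON THE WHOLE DOPING WINDOW OF RECORD `δ ∈ [0.10, 0.35]`

Instances, on the joined window `klU0WindowD010D035Rows` (`Theorems/WeakCouplingBCSDefsKlU0WindowD010D035Record.lean`, 222 rows on `μ ∈ [-0.8925, -0.1775]`), of the generic
window-rows theorems (`Theorems/WeakCouplingBCSKlThirdOrderSelectionWindow.lean`, `…KlSelectionWindowRows.lean`, `…KlSelectionBoxwiseRows.lean`), the join / constants facts being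
assembled from per-piece kernel decisions by `…KlSelectionJoinRows.lean`: for EVERY `μ ∈ [-0.8925, -0.1775]` (every hole doping `δ ∈ [0.10, 0.35]`) and every
`0 < U ≤ klU0WindowD010D035U` the `B1g` Ritz trial of the record box containing `μ` lies strictly below every normalised `A1g/A2g/B2g/E` state in the pp-irreducible
Cooper vertex `Γ_U/U²` through third order (chains resummed; to all orders for every remainder with the `C4 = 10` form bound), `B1g` has the strictly lowest third-order
channel bottom, and BOX-WISE the same holds up to each row's own `U0` — modulo the NAMED hypotheses `klCertB1gWin{U1,U2,U3,V,W,X,Y,Z,A,B,C}.EnclosuresB1g` (second order;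
margin-2 / cert-2 / cert-3, two implementations, referee-replayed) and the rows' named third-order / resummed window hypotheses (margin-1 FLOOR + chain layer, two
implementations; U0-TABLE.md v3 §4, v4 §B).  Existence-grade thresholds (≈ 10² below the float-informed estimates); `C4` ASSUMED; nothing here asserts superconductivity.

References: D. J. Scalapino, E. Loh, J. E. Hirsch, Phys. Rev. B 34 (1986) 8190, (3)–(4); S. Raghu, S. A. Kivelson, D. J. Scalapino,
Phys. Rev. B 81 (2010) 224505, App. A.
-/

noncomputable section

-- the tree's namespace `Summit.<Summit>.<Problem>.Theorems` repeats the summit name by design (D-0017)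
set_option linter.dupNamespace false

namespace Summit.HubbardSuperconductivity.HubbardSuperconductivity.Theorems

open MeasureTheory Literature.MathematicalPhysics.QuantumLattice CwKLChiralWindow KlThirdOrder
open Summit.HubbardSuperconductivity.HubbardSuperconductivity.Theses.WeakCouplingBCS

/-! ### Per-piece kernel facts (join to the second-order records, common constants) and their concatenation -/

/-- Kernel decision: every row of `klU0WindowU1Rows` sits in a box of `klCertB1gWinU1` with which it is consistent. [folklore] -/
theorem klsel_d010d035_join0 : klThirdOrderWindowJoin klU0WindowU1Rows [klCertB1gWinU1] = true := by
  decide +kernel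

/-- Kernel decision: every row of `klU0WindowU1Rows` carries `C4 = 10` and `U1 = 1/16`. [folklore] -/
theorem klsel_d010d035_consts0 :
    (klU0WindowU1Rows.all fun w => decide (w.row.C4 = (10 : ℚ)) && decide (w.row.U1 = ((1 : ℚ) / 16))) = true := by
  decide +kernel

/-- Kernel decision: every row of `klU0WindowU32Rows` sits in a box of `klCertB1gWinU3` / `klCertB1gWinU2` with which it is consistent. [folklore] -/
theorem klsel_d010d035_join1 : klThirdOrderWindowJoin klU0WindowU32Rows [klCertB1gWinU3, klCertB1gWinU2] = true := by
  decide +kernel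

/-- Kernel decision: every row of `klU0WindowU32Rows` carries `C4 = 10` and `U1 = 1/16`. [folklore] -/
theorem klsel_d010d035_consts1 :
    (klU0WindowU32Rows.all fun w => decide (w.row.C4 = (10 : ℚ)) && decide (w.row.U1 = ((1 : ℚ) / 16))) = true := by
  decide +kernel

/-- Kernel decision: every row of `klU0WindowWVRows` sits in a box of `klCertB1gWinW` / `klCertB1gWinV` with which it is consistent. [folklore] -/
theorem klsel_d010d035_join2 : klThirdOrderWindowJoin klU0WindowWVRows [klCertB1gWinW, klCertB1gWinV] = true := by
  decide +kernel

/-- Kernel decision: every row of `klU0WindowWVRows` carries `C4 = 10` and `U1 = 1/16`. [folklore] -/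
theorem klsel_d010d035_consts2 :
    (klU0WindowWVRows.all fun w => decide (w.row.C4 = (10 : ℚ)) && decide (w.row.U1 = ((1 : ℚ) / 16))) = true := by
  decide +kernel

/-- **The joined rows are joined to the union of the second-order records** (from the per-piece kernel decisions by `klThirdOrderWindowJoin_append_of`). [folklore] -/
theorem klsel_d010d035_join : klThirdOrderWindowJoin klU0WindowD010D035Rows [klCertB1gWinU1, klCertB1gWinU3, klCertB1gWinU2, klCertB1gWinW, klCertB1gWinV, klCertB1gWinY, klCertB1gWinX, klCertB1gWinZ, klCertB1gWinA, klCertB1gWinB, klCertB1gWinC] = true := by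
  have h : klThirdOrderWindowJoin (klU0WindowU1Rows ++ klU0WindowU32Rows ++ klU0WindowWVRows ++ klU0WindowYXRows ++ klU0WindowZRows ++ klU0WindowRows) ([klCertB1gWinU1] ++ [klCertB1gWinU3, klCertB1gWinU2] ++ [klCertB1gWinW, klCertB1gWinV] ++ [klCertB1gWinY, klCertB1gWinX] ++ [klCertB1gWinZ] ++ [klCertB1gWinA, klCertB1gWinB, klCertB1gWinC]) = true :=
    klThirdOrderWindowJoin_append_of (klThirdOrderWindowJoin_append_of (klThirdOrderWindowJoin_append_of (klThirdOrderWindowJoin_append_of (klThirdOrderWindowJoin_append_of (klsel_d010d035_join0) klsel_d010d035_join1) klsel_d010d035_join2) klsel_d010d030_join0) klsel_d010d030_join1) klto_window_join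
  exact h

/-- Every row of the joined list carries `C4 = 10` and `U1 = 1/16`. [folklore] -/
theorem klsel_d010d035_consts :
    (klU0WindowD010D035Rows.all fun w => decide (w.row.C4 = (10 : ℚ)) && decide (w.row.U1 = ((1 : ℚ) / 16))) = true := by
  have h : ((klU0WindowU1Rows ++ klU0WindowU32Rows ++ klU0WindowWVRows ++ klU0WindowYXRows ++ klU0WindowZRows ++ klU0WindowRows).all fun w => decide (w.row.C4 = (10 : ℚ)) && decide (w.row.U1 = ((1 : ℚ) / 16))) = true :=
    klWindowRowsConsts_append (klWindowRowsConsts_append (klWindowRowsConsts_append (klWindowRowsConsts_append (klWindowRowsConsts_append (klsel_d010d035_consts0) klsel_d010d035_consts1) klsel_d010d035_consts2) klsel_d010d030_consts0) klsel_d010d030_consts1) klaow_rows_consts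
  exact h

/-- The 11 second-order window records pass the multiplicity-aware checker (kernel decisions of their record files) and carry their enclosures. [folklore] -/
theorem klsel_d010d035_recs (hU1 : klCertB1gWinU1.EnclosuresB1g) (hU3 : klCertB1gWinU3.EnclosuresB1g) (hU2 : klCertB1gWinU2.EnclosuresB1g) (hW : klCertB1gWinW.EnclosuresB1g) (hV : klCertB1gWinV.EnclosuresB1g) (hY : klCertB1gWinY.EnclosuresB1g) (hX : klCertB1gWinX.EnclosuresB1g) (hZ : klCertB1gWinZ.EnclosuresB1g) (hA : klCertB1gWinA.EnclosuresB1g) (hB : klCertB1gWinB.EnclosuresB1g) (hC : klCertB1gWinC.EnclosuresB1g) :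
    ∀ c ∈ [klCertB1gWinU1, klCertB1gWinU3, klCertB1gWinU2, klCertB1gWinW, klCertB1gWinV, klCertB1gWinY, klCertB1gWinX, klCertB1gWinZ, klCertB1gWinA, klCertB1gWinB, klCertB1gWinC], c.checkB1gD = true ∧ c.EnclosuresB1g := by
  intro c hc
  simp only [List.mem_cons, List.mem_nil_iff, or_false] at hc
  rcases hc with rfl | rfl | rfl | rfl | rfl | rfl | rfl | rfl | rfl | rfl | rfl
  · exact ⟨klCertB1gWinU1_check, hU1⟩
  · exact ⟨klCertB1gWinU3_check, hU3⟩
  · exact ⟨klCertB1gWinU2_check, hU2⟩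
  · exact ⟨klCertB1gWinW_check, hW⟩
  · exact ⟨klCertB1gWinV_check, hV⟩
  · exact ⟨klCertB1gWinY_check, hY⟩
  · exact ⟨klCertB1gWinX_check, hX⟩
  · exact ⟨klCertB1gWinZ_check, hZ⟩
  · exact ⟨klCertB1gWinA_check, hA⟩
  · exact ⟨klCertB1gWinB_check, hB⟩
  · exact ⟨klCertB1gWinC_check, hC⟩

/-! ### Window-uniform statements on `μ ∈ [-0.8925, -0.1775]` -/

/-- **`B1g` selection survives the complete THIRD ORDER of the pp-irreducible Cooper vertex for every `μ ∈ [-0.8925, -0.1775]` and every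
`0 < U ≤ klU0WindowD010D035U`**: some `B1g` channel state on `F_μ` lies strictly below every normalised `A1g/A2g/B2g/E` state of `thirdOrderForm ε₀ μ U` —
modulo the NAMED numerical hypotheses `klCertB1gWin*.EnclosuresB1g` of the 11 second-order window records (certified interval computation of the
cell's window lanes, two implementations each) and the named window hypotheses of `klU0WindowD010D035Rows` (third order / resummed chains; certified in two interval
implementations on every box, U0-TABLE.md v3–v4).  Existence-grade threshold; nothing here asserts a pairing instability. [cite: RaghuKivelsonScalapino2010, App. A] -/
theorem klThirdOrder_selection_d010d035 (hU1 : klCertB1gWinU1.EnclosuresB1g) (hU3 : klCertB1gWinU3.EnclosuresB1g) (hU2 : klCertB1gWinU2.EnclosuresB1g) (hW : klCertB1gWinW.EnclosuresB1g) (hV : klCertB1gWinV.EnclosuresB1g) (hY : klCertB1gWinY.EnclosuresB1g) (hX : klCertB1gWinX.EnclosuresB1g) (hZ : klCertB1gWinZ.EnclosuresB1g) (hA : klCertB1gWinA.EnclosuresB1g) (hB : klCertB1gWinB.EnclosuresB1g) (hC : klCertB1gWinC.EnclosuresB1g)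
    (h3 : KlThirdOrderWindowEnclosures klU0WindowD010D035Rows [klCertB1gWinU1, klCertB1gWinU3, klCertB1gWinU2, klCertB1gWinW, klCertB1gWinV, klCertB1gWinY, klCertB1gWinX, klCertB1gWinZ, klCertB1gWinA, klCertB1gWinB, klCertB1gWinC]) :
    ∀ μ : ℝ, ((((-357 : ℚ) / 400) : ℚ) : ℝ) ≤ μ → μ ≤ ((((-71 : ℚ) / 400) : ℚ) : ℝ) →
      ∃ ψ : Momentum → ℝ, IsChannelState (squareDispersion 1 0) μ D4Irrep.B1g ψ ∧
        ∀ U : ℝ, 0 < U → U ≤ ((klU0WindowD010D035U : ℚ) : ℝ) → ∀ χ : D4Irrep, χ ≠ D4Irrep.B1g →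
          ∀ φ : Momentum → ℝ, IsChannelState (squareDispersion 1 0) μ χ φ →
            thirdOrderForm (squareDispersion 1 0) μ U ψ < thirdOrderForm (squareDispersion 1 0) μ U φ :=
  klThirdOrder_selection_windowRows klU0WindowD010D035Rows _ _ _ _ klU0WindowD010D035Rows_check klsel_d010d035_join (klsel_d010d035_recs hU1 hU3 hU2 hW hV hY hX hZ hA hB hC) h3

/-- **Chains RESUMMED, every `μ ∈ [-0.8925, -0.1775]`, `0 < U ≤ klU0WindowD010D035U`** — modulo the NAMED numerical hypotheses `klCertB1gWin*.EnclosuresB1g` of the 11 second-order window records (certified interval computation of the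
cell's window lanes, two implementations each) and the named window hypotheses of `klU0WindowD010D035Rows` (third order / resummed chains; certified in two interval
implementations on every box, U0-TABLE.md v3–v4).  Existence-grade threshold; nothing here asserts a pairing instability. [cite: ScalapinoLohHirsch1986, (3)-(4)] -/
theorem klResummed_selection_d010d035 (hU1 : klCertB1gWinU1.EnclosuresB1g) (hU3 : klCertB1gWinU3.EnclosuresB1g) (hU2 : klCertB1gWinU2.EnclosuresB1g) (hW : klCertB1gWinW.EnclosuresB1g) (hV : klCertB1gWinV.EnclosuresB1g) (hY : klCertB1gWinY.EnclosuresB1g) (hX : klCertB1gWinX.EnclosuresB1g) (hZ : klCertB1gWinZ.EnclosuresB1g) (hA : klCertB1gWinA.EnclosuresB1g) (hB : klCertB1gWinB.EnclosuresB1g) (hC : klCertB1gWinC.EnclosuresB1g)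
    (h3 : KlResummedWindowEnclosures klU0WindowD010D035Rows [klCertB1gWinU1, klCertB1gWinU3, klCertB1gWinU2, klCertB1gWinW, klCertB1gWinV, klCertB1gWinY, klCertB1gWinX, klCertB1gWinZ, klCertB1gWinA, klCertB1gWinB, klCertB1gWinC]) :
    ∀ μ : ℝ, ((((-357 : ℚ) / 400) : ℚ) : ℝ) ≤ μ → μ ≤ ((((-71 : ℚ) / 400) : ℚ) : ℝ) →
      ∃ ψ : Momentum → ℝ, IsChannelState (squareDispersion 1 0) μ D4Irrep.B1g ψ ∧
        ∀ U : ℝ, 0 < U → U ≤ ((klU0WindowD010D035U : ℚ) : ℝ) → ∀ χ : D4Irrep, χ ≠ D4Irrep.B1g →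
          ∀ φ : Momentum → ℝ, IsChannelState (squareDispersion 1 0) μ χ φ →
            resummedForm (squareDispersion 1 0) μ U ψ < resummedForm (squareDispersion 1 0) μ U φ :=
  klResummed_selection_windowRows klU0WindowD010D035Rows _ _ _ _ klU0WindowD010D035Rows_check klsel_d010d035_join (klsel_d010d035_recs hU1 hU3 hU2 hW hV hY hX hZ hA hB hC) h3

/-- **ALL ORDERS, every `μ ∈ [-0.8925, -0.1775]`, `0 < U ≤ klU0WindowD010D035U`**, for EVERY coupling-dependent remainder kernel `R` (the non-chain diagrams of order `≥ 4`
of `Γ_U/U⁴`) whose form is `≤ 10‖Φ_B‖²` on the `B1g` trial of every record box and `≥ -10` on normalised competitor states for `0 < U ≤ 1/16` — the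
rows' ASSUMED `C4 = 10` column as a theorem; modulo the NAMED numerical hypotheses `klCertB1gWin*.EnclosuresB1g` of the 11 second-order window records (certified interval computation of the
cell's window lanes, two implementations each) and the named window hypotheses of `klU0WindowD010D035Rows` (third order / resummed chains; certified in two interval
implementations on every box, U0-TABLE.md v3–v4).  Existence-grade threshold; nothing here asserts a pairing instability. [cite: RaghuKivelsonScalapino2010, App. A] -/
theorem klAllOrders_selection_d010d035 (hU1 : klCertB1gWinU1.EnclosuresB1g) (hU3 : klCertB1gWinU3.EnclosuresB1g) (hU2 : klCertB1gWinU2.EnclosuresB1g) (hW : klCertB1gWinW.EnclosuresB1g) (hV : klCertB1gWinV.EnclosuresB1g) (hY : klCertB1gWinY.EnclosuresB1g) (hX : klCertB1gWinX.EnclosuresB1g) (hZ : klCertB1gWinZ.EnclosuresB1g) (hA : klCertB1gWinA.EnclosuresB1g) (hB : klCertB1gWinB.EnclosuresB1g) (hC : klCertB1gWinC.EnclosuresB1g)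
    (h3 : KlResummedWindowEnclosures klU0WindowD010D035Rows [klCertB1gWinU1, klCertB1gWinU3, klCertB1gWinU2, klCertB1gWinW, klCertB1gWinV, klCertB1gWinY, klCertB1gWinX, klCertB1gWinZ, klCertB1gWinA, klCertB1gWinB, klCertB1gWinC])
    (R : ℝ → Momentum → Momentum → ℝ)
    (hRB : ∀ c ∈ [klCertB1gWinU1, klCertB1gWinU3, klCertB1gWinU2, klCertB1gWinW, klCertB1gWinV, klCertB1gWinY, klCertB1gWinX, klCertB1gWinZ, klCertB1gWinA, klCertB1gWinB, klCertB1gWinC], ∀ bx ∈ c.boxes, ∀ μ : ℝ,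
      ((bx.mulo : ℚ) : ℝ) ≤ μ → μ ≤ ((bx.muhi : ℚ) : ℝ) → ∀ U : ℝ, 0 < U → U ≤ ((((1 : ℚ) / 16) : ℚ) : ℝ) →
        kform (fermiCurveMeasure (squareDispersion 1 0) μ) (R U) (bx.bB1g.trialFun c.trials) ≤
          (((10 : ℚ) : ℚ) : ℝ) * ∫ k, bx.bB1g.trialFun c.trials k ^ 2 ∂fermiCurveMeasure (squareDispersion 1 0) μ)
    (hRχ : ∀ μ : ℝ, ((((-357 : ℚ) / 400) : ℚ) : ℝ) ≤ μ → μ ≤ ((((-71 : ℚ) / 400) : ℚ) : ℝ) →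
      ∀ U : ℝ, 0 < U → U ≤ ((((1 : ℚ) / 16) : ℚ) : ℝ) → ∀ χ : D4Irrep, χ ≠ D4Irrep.B1g →
        ∀ φ : Momentum → ℝ, IsChannelState (squareDispersion 1 0) μ χ φ →
          -(((10 : ℚ) : ℚ) : ℝ) ≤ kform (fermiCurveMeasure (squareDispersion 1 0) μ) (R U) φ) :
    ∀ μ : ℝ, ((((-357 : ℚ) / 400) : ℚ) : ℝ) ≤ μ → μ ≤ ((((-71 : ℚ) / 400) : ℚ) : ℝ) →
      ∃ ψ : Momentum → ℝ, IsChannelState (squareDispersion 1 0) μ D4Irrep.B1g ψ ∧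
        ∀ U : ℝ, 0 < U → U ≤ ((klU0WindowD010D035U : ℚ) : ℝ) → ∀ χ : D4Irrep, χ ≠ D4Irrep.B1g →
          ∀ φ : Momentum → ℝ, IsChannelState (squareDispersion 1 0) μ χ φ →
            resummedForm (squareDispersion 1 0) μ U ψ + U ^ 2 * kform (fermiCurveMeasure (squareDispersion 1 0) μ) (R U) ψ <
              resummedForm (squareDispersion 1 0) μ U φ + U ^ 2 * kform (fermiCurveMeasure (squareDispersion 1 0) μ) (R U) φ :=
  klAllOrders_selection_windowRows klU0WindowD010D035Rows _ _ _ _ _ _ klU0WindowD010D035Rows_check klsel_d010d035_join (klsel_d010d035_recs hU1 hU3 hU2 hW hV hY hX hZ hA hB hC) h3 klsel_d010d035_consts R hRB hRχ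

/-- **`B1g` trial below every competitor's third-order CHANNEL BOTTOM, every `μ ∈ [-0.8925, -0.1775]`, `0 < U ≤ klU0WindowD010D035U`** —
modulo the NAMED numerical hypotheses `klCertB1gWin*.EnclosuresB1g` of the 11 second-order window records (certified interval computation of the
cell's window lanes, two implementations each) and the named window hypotheses of `klU0WindowD010D035Rows` (third order / resummed chains; certified in two interval
implementations on every box, U0-TABLE.md v3–v4).  Existence-grade threshold; nothing here asserts a pairing instability. [cite: RaghuKivelsonScalapino2010, App. A] -/
theorem klThirdOrder_lt_channelInf3_d010d035 (hU1 : klCertB1gWinU1.EnclosuresB1g) (hU3 : klCertB1gWinU3.EnclosuresB1g) (hU2 : klCertB1gWinU2.EnclosuresB1g) (hW : klCertB1gWinW.EnclosuresB1g) (hV : klCertB1gWinV.EnclosuresB1g) (hY : klCertB1gWinY.EnclosuresB1g) (hX : klCertB1gWinX.EnclosuresB1g) (hZ : klCertB1gWinZ.EnclosuresB1g) (hA : klCertB1gWinA.EnclosuresB1g) (hB : klCertB1gWinB.EnclosuresB1g) (hC : klCertB1gWinC.EnclosuresB1g)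
    (h3 : KlThirdOrderWindowEnclosures klU0WindowD010D035Rows [klCertB1gWinU1, klCertB1gWinU3, klCertB1gWinU2, klCertB1gWinW, klCertB1gWinV, klCertB1gWinY, klCertB1gWinX, klCertB1gWinZ, klCertB1gWinA, klCertB1gWinB, klCertB1gWinC]) :
    ∀ μ : ℝ, ((((-357 : ℚ) / 400) : ℚ) : ℝ) ≤ μ → μ ≤ ((((-71 : ℚ) / 400) : ℚ) : ℝ) →
      ∃ ψ : Momentum → ℝ, IsChannelState (squareDispersion 1 0) μ D4Irrep.B1g ψ ∧
        ∀ U : ℝ, 0 < U → U ≤ ((klU0WindowD010D035U : ℚ) : ℝ) → ∀ χ : D4Irrep, χ ≠ D4Irrep.B1g →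
          thirdOrderForm (squareDispersion 1 0) μ U ψ < channelInf3 (squareDispersion 1 0) μ U χ :=
  klThirdOrder_lt_channelInf3_windowRows klU0WindowD010D035Rows _ _ _ _ klU0WindowD010D035Rows_check klsel_d010d035_join (klsel_d010d035_recs hU1 hU3 hU2 hW hV hY hX hZ hA hB hC) h3

/-- **`B1g` has the strictly lowest third-order channel bottom, every `μ ∈ [-0.8925, -0.1775]`, `0 < U ≤ klU0WindowD010D035U`, every `χ ∈ {A1g, A2g, B2g, E}`** —
modulo the NAMED numerical hypotheses `klCertB1gWin*.EnclosuresB1g` of the 11 second-order window records (certified interval computation of the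
cell's window lanes, two implementations each) and the named window hypotheses of `klU0WindowD010D035Rows` (third order / resummed chains; certified in two interval
implementations on every box, U0-TABLE.md v3–v4).  Existence-grade threshold; nothing here asserts a pairing instability.  Extra named hypothesis: per row, its `A2g` datum read on the `B1g` states (channel-independent Hilbert–Schmidt numbers, valid on every even
state). [cite: RaghuKivelsonScalapino2010, App. A] -/
theorem klThirdOrder_channelInf3_lt_d010d035 (hU1 : klCertB1gWinU1.EnclosuresB1g) (hU3 : klCertB1gWinU3.EnclosuresB1g) (hU2 : klCertB1gWinU2.EnclosuresB1g) (hW : klCertB1gWinW.EnclosuresB1g) (hV : klCertB1gWinV.EnclosuresB1g) (hY : klCertB1gWinY.EnclosuresB1g) (hX : klCertB1gWinX.EnclosuresB1g) (hZ : klCertB1gWinZ.EnclosuresB1g) (hA : klCertB1gWinA.EnclosuresB1g) (hB : klCertB1gWinB.EnclosuresB1g) (hC : klCertB1gWinC.EnclosuresB1g)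
    (h3 : KlThirdOrderWindowEnclosures klU0WindowD010D035Rows [klCertB1gWinU1, klCertB1gWinU3, klCertB1gWinU2, klCertB1gWinW, klCertB1gWinV, klCertB1gWinY, klCertB1gWinX, klCertB1gWinZ, klCertB1gWinA, klCertB1gWinB, klCertB1gWinC])
    (hB1g : ∀ w ∈ klU0WindowD010D035Rows, ∀ μ : ℝ, ((w.mulo : ℚ) : ℝ) ≤ μ → μ ≤ ((w.muhi : ℚ) : ℝ) →
      (w.row.chanOf D4Irrep.A2g).ThirdOrderLowerBound μ D4Irrep.B1g) :
    ∀ μ : ℝ, ((((-357 : ℚ) / 400) : ℚ) : ℝ) ≤ μ → μ ≤ ((((-71 : ℚ) / 400) : ℚ) : ℝ) →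
      ∀ U : ℝ, 0 < U → U ≤ ((klU0WindowD010D035U : ℚ) : ℝ) → ∀ χ : D4Irrep, χ ≠ D4Irrep.B1g →
        channelInf3 (squareDispersion 1 0) μ U D4Irrep.B1g < channelInf3 (squareDispersion 1 0) μ U χ :=
  klThirdOrder_channelInf3_lt_windowRows klU0WindowD010D035Rows _ _ _ _ klU0WindowD010D035Rows_check klsel_d010d035_join (klsel_d010d035_recs hU1 hU3 hU2 hW hV hY hX hZ hA hB hC) h3 hB1g

/-! ### Box-wise thresholds `U₀(μ)`: for every row `w`, every `μ` of its box, `0 < U ≤ w.row.U0` -/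

/-- **Box-wise third-order selection on the joined window**: thresholds `w.row.U0` per box. [cite: RaghuKivelsonScalapino2010, App. A] -/
theorem klThirdOrder_selection_d010d035_boxwise (hU1 : klCertB1gWinU1.EnclosuresB1g) (hU3 : klCertB1gWinU3.EnclosuresB1g) (hU2 : klCertB1gWinU2.EnclosuresB1g) (hW : klCertB1gWinW.EnclosuresB1g) (hV : klCertB1gWinV.EnclosuresB1g) (hY : klCertB1gWinY.EnclosuresB1g) (hX : klCertB1gWinX.EnclosuresB1g) (hZ : klCertB1gWinZ.EnclosuresB1g) (hA : klCertB1gWinA.EnclosuresB1g) (hB : klCertB1gWinB.EnclosuresB1g) (hC : klCertB1gWinC.EnclosuresB1g)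
    (h3 : KlThirdOrderWindowEnclosures klU0WindowD010D035Rows [klCertB1gWinU1, klCertB1gWinU3, klCertB1gWinU2, klCertB1gWinW, klCertB1gWinV, klCertB1gWinY, klCertB1gWinX, klCertB1gWinZ, klCertB1gWinA, klCertB1gWinB, klCertB1gWinC]) :
    ∀ w ∈ klU0WindowD010D035Rows, ∀ μ : ℝ, ((w.mulo : ℚ) : ℝ) ≤ μ → μ ≤ ((w.muhi : ℚ) : ℝ) →
      ∃ ψ : Momentum → ℝ, IsChannelState (squareDispersion 1 0) μ D4Irrep.B1g ψ ∧
        ∀ U : ℝ, 0 < U → U ≤ ((w.row.U0 : ℚ) : ℝ) → ∀ χ : D4Irrep, χ ≠ D4Irrep.B1g →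
          ∀ φ : Momentum → ℝ, IsChannelState (squareDispersion 1 0) μ χ φ →
            thirdOrderForm (squareDispersion 1 0) μ U ψ < thirdOrderForm (squareDispersion 1 0) μ U φ :=
  klThirdOrder_selection_boxwiseRows klU0WindowD010D035Rows _ _ _ _ klU0WindowD010D035Rows_check klsel_d010d035_join (klsel_d010d035_recs hU1 hU3 hU2 hW hV hY hX hZ hA hB hC) h3

/-- **Box-wise selection with the chains resummed on the joined window.** [cite: ScalapinoLohHirsch1986, (3)-(4)] -/
theorem klResummed_selection_d010d035_boxwise (hU1 : klCertB1gWinU1.EnclosuresB1g) (hU3 : klCertB1gWinU3.EnclosuresB1g) (hU2 : klCertB1gWinU2.EnclosuresB1g) (hW : klCertB1gWinW.EnclosuresB1g) (hV : klCertB1gWinV.EnclosuresB1g) (hY : klCertB1gWinY.EnclosuresB1g) (hX : klCertB1gWinX.EnclosuresB1g) (hZ : klCertB1gWinZ.EnclosuresB1g) (hA : klCertB1gWinA.EnclosuresB1g) (hB : klCertB1gWinB.EnclosuresB1g) (hC : klCertB1gWinC.EnclosuresB1g)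
    (h3 : KlResummedWindowEnclosures klU0WindowD010D035Rows [klCertB1gWinU1, klCertB1gWinU3, klCertB1gWinU2, klCertB1gWinW, klCertB1gWinV, klCertB1gWinY, klCertB1gWinX, klCertB1gWinZ, klCertB1gWinA, klCertB1gWinB, klCertB1gWinC]) :
    ∀ w ∈ klU0WindowD010D035Rows, ∀ μ : ℝ, ((w.mulo : ℚ) : ℝ) ≤ μ → μ ≤ ((w.muhi : ℚ) : ℝ) →
      ∃ ψ : Momentum → ℝ, IsChannelState (squareDispersion 1 0) μ D4Irrep.B1g ψ ∧
        ∀ U : ℝ, 0 < U → U ≤ ((w.row.U0 : ℚ) : ℝ) → ∀ χ : D4Irrep, χ ≠ D4Irrep.B1g →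
          ∀ φ : Momentum → ℝ, IsChannelState (squareDispersion 1 0) μ χ φ →
            resummedForm (squareDispersion 1 0) μ U ψ < resummedForm (squareDispersion 1 0) μ U φ :=
  klResummed_selection_boxwiseRows klU0WindowD010D035Rows _ _ _ _ klU0WindowD010D035Rows_check klsel_d010d035_join (klsel_d010d035_recs hU1 hU3 hU2 hW hV hY hX hZ hA hB hC) h3

/-- **Box-wise channel bottoms on the joined window**: for every row `w`, every `μ` of its box, `0 < U ≤ w.row.U0`, every `χ ≠ B1g`:
`channelInf3 ε₀ μ U B1g < channelInf3 ε₀ μ U χ`. [cite: RaghuKivelsonScalapino2010, App. A] -/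
theorem klThirdOrder_channelInf3_lt_d010d035_boxwise (hU1 : klCertB1gWinU1.EnclosuresB1g) (hU3 : klCertB1gWinU3.EnclosuresB1g) (hU2 : klCertB1gWinU2.EnclosuresB1g) (hW : klCertB1gWinW.EnclosuresB1g) (hV : klCertB1gWinV.EnclosuresB1g) (hY : klCertB1gWinY.EnclosuresB1g) (hX : klCertB1gWinX.EnclosuresB1g) (hZ : klCertB1gWinZ.EnclosuresB1g) (hA : klCertB1gWinA.EnclosuresB1g) (hB : klCertB1gWinB.EnclosuresB1g) (hC : klCertB1gWinC.EnclosuresB1g)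
    (h3 : KlThirdOrderWindowEnclosures klU0WindowD010D035Rows [klCertB1gWinU1, klCertB1gWinU3, klCertB1gWinU2, klCertB1gWinW, klCertB1gWinV, klCertB1gWinY, klCertB1gWinX, klCertB1gWinZ, klCertB1gWinA, klCertB1gWinB, klCertB1gWinC])
    (hB1g : ∀ w ∈ klU0WindowD010D035Rows, ∀ μ : ℝ, ((w.mulo : ℚ) : ℝ) ≤ μ → μ ≤ ((w.muhi : ℚ) : ℝ) →
      (w.row.chanOf D4Irrep.A2g).ThirdOrderLowerBound μ D4Irrep.B1g) :
    ∀ w ∈ klU0WindowD010D035Rows, ∀ μ : ℝ, ((w.mulo : ℚ) : ℝ) ≤ μ → μ ≤ ((w.muhi : ℚ) : ℝ) →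
      ∀ U : ℝ, 0 < U → U ≤ ((w.row.U0 : ℚ) : ℝ) → ∀ χ : D4Irrep, χ ≠ D4Irrep.B1g →
        channelInf3 (squareDispersion 1 0) μ U D4Irrep.B1g < channelInf3 (squareDispersion 1 0) μ U χ :=
  klThirdOrder_channelInf3_lt_boxwiseRows klU0WindowD010D035Rows _ _ _ _ klU0WindowD010D035Rows_check klsel_d010d035_join (klsel_d010d035_recs hU1 hU3 hU2 hW hV hY hX hZ hA hB hC) h3 hB1g

/-! ### Indexed by the doping `δ ∈ [0.10, 0.35]` (`muOfDoping_mem_window_d010_d035`: certified fillings n(-0.8925) < 13/20, n(-0.1775) ≥ 9/10) -/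

/-- **For every `δ ∈ [0.10, 0.35]`, at `μ(δ) = chemicalPotentialOfDensity ε₀ (1-δ)`: third-order `B1g` selection for `0 < U ≤ klU0WindowD010D035U`**,
modulo the same named hypotheses. [cite: RaghuKivelsonScalapino2010, App. A] -/
theorem klThirdOrder_selection_d010d035_doping (hU1 : klCertB1gWinU1.EnclosuresB1g) (hU3 : klCertB1gWinU3.EnclosuresB1g) (hU2 : klCertB1gWinU2.EnclosuresB1g) (hW : klCertB1gWinW.EnclosuresB1g) (hV : klCertB1gWinV.EnclosuresB1g) (hY : klCertB1gWinY.EnclosuresB1g) (hX : klCertB1gWinX.EnclosuresB1g) (hZ : klCertB1gWinZ.EnclosuresB1g) (hA : klCertB1gWinA.EnclosuresB1g) (hB : klCertB1gWinB.EnclosuresB1g) (hC : klCertB1gWinC.EnclosuresB1g)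
    (h3 : KlThirdOrderWindowEnclosures klU0WindowD010D035Rows [klCertB1gWinU1, klCertB1gWinU3, klCertB1gWinU2, klCertB1gWinW, klCertB1gWinV, klCertB1gWinY, klCertB1gWinX, klCertB1gWinZ, klCertB1gWinA, klCertB1gWinB, klCertB1gWinC])
    (δ : ℝ) (hδ : δ ∈ Set.Icc (0.10 : ℝ) 0.35) :
    ∃ ψ : Momentum → ℝ, IsChannelState (squareDispersion 1 0) (chemicalPotentialOfDensity (squareDispersion 1 0) (1 - δ)) D4Irrep.B1g ψ ∧
      ∀ U : ℝ, 0 < U → U ≤ ((klU0WindowD010D035U : ℚ) : ℝ) → ∀ χ : D4Irrep, χ ≠ D4Irrep.B1g →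
        ∀ φ : Momentum → ℝ, IsChannelState (squareDispersion 1 0) (chemicalPotentialOfDensity (squareDispersion 1 0) (1 - δ)) χ φ →
          thirdOrderForm (squareDispersion 1 0) (chemicalPotentialOfDensity (squareDispersion 1 0) (1 - δ)) U ψ < thirdOrderForm (squareDispersion 1 0) (chemicalPotentialOfDensity (squareDispersion 1 0) (1 - δ)) U φ := by
  obtain ⟨h₁, h₂⟩ := muOfDoping_mem_window_d010_d035 δ hδ
  exact klThirdOrder_selection_d010d035 hU1 hU3 hU2 hW hV hY hX hZ hA hB hC h3 _ (by push_cast; linarith) (by push_cast; linarith)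

/-- **For every `δ ∈ [0.10, 0.35]`, chains resummed**: `B1g` selection in `resummedForm` at `μ(δ)` for `0 < U ≤ klU0WindowD010D035U`. [cite: ScalapinoLohHirsch1986, (3)-(4)] -/
theorem klResummed_selection_d010d035_doping (hU1 : klCertB1gWinU1.EnclosuresB1g) (hU3 : klCertB1gWinU3.EnclosuresB1g) (hU2 : klCertB1gWinU2.EnclosuresB1g) (hW : klCertB1gWinW.EnclosuresB1g) (hV : klCertB1gWinV.EnclosuresB1g) (hY : klCertB1gWinY.EnclosuresB1g) (hX : klCertB1gWinX.EnclosuresB1g) (hZ : klCertB1gWinZ.EnclosuresB1g) (hA : klCertB1gWinA.EnclosuresB1g) (hB : klCertB1gWinB.EnclosuresB1g) (hC : klCertB1gWinC.EnclosuresB1g)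
    (h3 : KlResummedWindowEnclosures klU0WindowD010D035Rows [klCertB1gWinU1, klCertB1gWinU3, klCertB1gWinU2, klCertB1gWinW, klCertB1gWinV, klCertB1gWinY, klCertB1gWinX, klCertB1gWinZ, klCertB1gWinA, klCertB1gWinB, klCertB1gWinC])
    (δ : ℝ) (hδ : δ ∈ Set.Icc (0.10 : ℝ) 0.35) :
    ∃ ψ : Momentum → ℝ, IsChannelState (squareDispersion 1 0) (chemicalPotentialOfDensity (squareDispersion 1 0) (1 - δ)) D4Irrep.B1g ψ ∧
      ∀ U : ℝ, 0 < U → U ≤ ((klU0WindowD010D035U : ℚ) : ℝ) → ∀ χ : D4Irrep, χ ≠ D4Irrep.B1g →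
        ∀ φ : Momentum → ℝ, IsChannelState (squareDispersion 1 0) (chemicalPotentialOfDensity (squareDispersion 1 0) (1 - δ)) χ φ →
          resummedForm (squareDispersion 1 0) (chemicalPotentialOfDensity (squareDispersion 1 0) (1 - δ)) U ψ < resummedForm (squareDispersion 1 0) (chemicalPotentialOfDensity (squareDispersion 1 0) (1 - δ)) U φ := by
  obtain ⟨h₁, h₂⟩ := muOfDoping_mem_window_d010_d035 δ hδ
  exact klResummed_selection_d010d035 hU1 hU3 hU2 hW hV hY hX hZ hA hB hC h3 _ (by push_cast; linarith) (by push_cast; linarith)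

/-- **For every `δ ∈ [0.10, 0.35]`, channel bottoms**: at `μ(δ)`, every `0 < U ≤ klU0WindowD010D035U`, every `χ ≠ B1g`:
`channelInf3 ε₀ μ(δ) U B1g < channelInf3 ε₀ μ(δ) U χ`. [cite: RaghuKivelsonScalapino2010, App. A] -/
theorem klThirdOrder_channelInf3_lt_d010d035_doping (hU1 : klCertB1gWinU1.EnclosuresB1g) (hU3 : klCertB1gWinU3.EnclosuresB1g) (hU2 : klCertB1gWinU2.EnclosuresB1g) (hW : klCertB1gWinW.EnclosuresB1g) (hV : klCertB1gWinV.EnclosuresB1g) (hY : klCertB1gWinY.EnclosuresB1g) (hX : klCertB1gWinX.EnclosuresB1g) (hZ : klCertB1gWinZ.EnclosuresB1g) (hA : klCertB1gWinA.EnclosuresB1g) (hB : klCertB1gWinB.EnclosuresB1g) (hC : klCertB1gWinC.EnclosuresB1g)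
    (h3 : KlThirdOrderWindowEnclosures klU0WindowD010D035Rows [klCertB1gWinU1, klCertB1gWinU3, klCertB1gWinU2, klCertB1gWinW, klCertB1gWinV, klCertB1gWinY, klCertB1gWinX, klCertB1gWinZ, klCertB1gWinA, klCertB1gWinB, klCertB1gWinC])
    (hB1g : ∀ w ∈ klU0WindowD010D035Rows, ∀ μ : ℝ, ((w.mulo : ℚ) : ℝ) ≤ μ → μ ≤ ((w.muhi : ℚ) : ℝ) →
      (w.row.chanOf D4Irrep.A2g).ThirdOrderLowerBound μ D4Irrep.B1g)
    (δ : ℝ) (hδ : δ ∈ Set.Icc (0.10 : ℝ) 0.35) :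
    ∀ U : ℝ, 0 < U → U ≤ ((klU0WindowD010D035U : ℚ) : ℝ) → ∀ χ : D4Irrep, χ ≠ D4Irrep.B1g →
      channelInf3 (squareDispersion 1 0) (chemicalPotentialOfDensity (squareDispersion 1 0) (1 - δ)) U D4Irrep.B1g < channelInf3 (squareDispersion 1 0) (chemicalPotentialOfDensity (squareDispersion 1 0) (1 - δ)) U χ := by
  obtain ⟨h₁, h₂⟩ := muOfDoping_mem_window_d010_d035 δ hδ
  exact klThirdOrder_channelInf3_lt_d010d035 hU1 hU3 hU2 hW hV hY hX hZ hA hB hC h3 hB1g _ (by push_cast; linarith) (by push_cast; linarith)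

end Summit.HubbardSuperconductivity.HubbardSuperconductivity.Theorems

end
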